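import Mathlib
import Summits.PneNP.PneNP.Theorems.OverlapGapAlgebraSearchHardWindowRadiusLocal
import Summits.PneNP.PneNP.Theorems.OverlapGapAlgebraSearchHardWindowSequentialLocalSens

/-!
# PneNP / OverlapGapAlgebra — `SearchHardWindow` / `SolvableImpliesStableSection`:
# sequential local decimation followed by LOCAL POST-PROCESSING (1/3) — light cones

Support for cruxes `stmt-PneNP-2460` and `stmt-PneNP-2463`. The sequential local rung
(`…SequentialLocalSens/Rung`) is robust under bounded-radius post-processing: let `g₀` be an
index-order decimation rule with unit look-ahead (hypothesis `hseq`) and let the search map `g` be a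
RADIUS-`r` LOCAL FUNCTION OF THE PAIR `(Φ, g₀ Φ)` (hypothesis `hpost`, definition-free): the bit of
`g` at `v` is an arbitrary label-dependent function of the labelled clauses that `v` sees within
radius `r` and of the bits of `g₀ Φ` on the radius-`r` ball of `v` — e.g. decimation followed by `r`
rounds of parallel local repair, of Warning/Belief Propagation re-estimation and rounding, or of any
deterministic local search with bounded range run on the decimated assignment.

* `shwSeqP_cone` — if `Φ, Φ'` differ in one literal of clause `a`, then `g Φ` and `g Φ'` differ only
  at variables that see `a` within radius `r` (in `Φ` or `Φ'`) or lie within radius `r` of the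
  increasing cone of the variables of clause `a` (old and new);
* `shwSeqP_hamming_le` — hence `d_H(g Φ, g Φ') ≤ k(kD+1)^r + k(kD+k+1)^r + (kD+1)^r (∑_q T_{∖a,q} + T_ℓ)`
  with `D` the maximum clause-degree of `Φ` and `T` the increasing-cone sizes of `…SequentialLocalSens`;
* `shwSeqP_hamming_sq_le` — the squared form used by the mean-square bound (file 2/3).
No definitions; axioms `propext`, `Classical.choice`, `Quot.sound`.
-/

set_option linter.dupNamespace false -- `Summit.PneNP.PneNP.…`: summit = sub-problem (D-0017)

namespace Summit.PneNP.PneNP.Theorems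

open Finset
open scoped Classical

section SeqPost

variable {m k n : ℕ}

/-- **Light cone of a post-processed sequential local rule.** -/
theorem shwSeqP_cone (r : ℕ) (g₀ g : (Fin m → Fin k → Fin n × Bool) → (Fin n → Bool)) (hseq : (∀ (Φ Φ' : (Fin m → Fin k → Fin n × Bool)) (v : Fin n),
        (∀ i : Fin m, ((∃ j : Fin k, (Φ i j).1 = v) ∨ (∃ j : Fin k, (Φ' i j).1 = v)) → Φ i = Φ' i) →
        (∀ (i : Fin m) (j j' : Fin k), (Φ i j).1 = v → (Φ i j').1 < v →
          g₀ Φ (Φ i j').1 = g₀ Φ' (Φ i j').1) →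
        g₀ Φ v = g₀ Φ' v))
    (hpost : (∀ (Φ Φ' : (Fin m → Fin k → Fin n × Bool)) (v : Fin n),
        (∀ i : Fin m, ((∃ j : Fin k, ∃ pw : ℕ → Fin n, pw 0 = v ∧ pw r = (Φ i j).1 ∧
          (∀ s, s < r → (pw s = pw (s + 1) ∨
            ∃ i' : Fin m, ∃ j₁ j₂ : Fin k, (Φ i' j₁).1 = pw s ∧ (Φ i' j₂).1 = pw (s + 1)))) ∨
         (∃ j : Fin k, ∃ pw : ℕ → Fin n, pw 0 = v ∧ pw r = (Φ' i j).1 ∧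
          (∀ s, s < r → (pw s = pw (s + 1) ∨
            ∃ i' : Fin m, ∃ j₁ j₂ : Fin k, (Φ' i' j₁).1 = pw s ∧ (Φ' i' j₂).1 = pw (s + 1))))) → Φ i = Φ' i) →
        (∀ u : Fin n, (∃ pw : ℕ → Fin n, pw 0 = v ∧ pw r = u ∧
          (∀ s, s < r → (pw s = pw (s + 1) ∨
            ∃ i' : Fin m, ∃ j₁ j₂ : Fin k, (Φ i' j₁).1 = pw s ∧ (Φ i' j₂).1 = pw (s + 1)))) → g₀ Φ u = g₀ Φ' u) →
        g Φ v = g Φ' v)) (Φ : (Fin m → Fin k → Fin n × Bool)) (a : Fin m) (b : Fin k) (ℓ : Fin n × Bool) (v : Fin n)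
    (hv : g Φ v ≠ g (Function.update Φ a (Function.update (Φ a) b ℓ)) v) :
    v ∈ ((Finset.univ : Finset (Fin n)).filter fun v => ∃ j : Fin k, ∃ p : ℕ → Fin n, p 0 = v ∧
        p r = (Φ a j).1 ∧ ∀ s, s < r → (p s = p (s + 1) ∨
          ∃ i : Fin m, ∃ j j' : Fin k, (Φ i j).1 = p s ∧ (Φ i j').1 = p (s + 1))) ∨
      v ∈ ((Finset.univ : Finset (Fin n)).filter fun v => ∃ j : Fin k, ∃ p : ℕ → Fin n, p 0 = v ∧
        p r = ((Function.update Φ a (Function.update (Φ a) b ℓ)) a j).1 ∧ ∀ s, s < r → (p s = p (s + 1) ∨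
          ∃ i : Fin m, ∃ j j' : Fin k, ((Function.update Φ a (Function.update (Φ a) b ℓ)) i j).1 = p s ∧ ((Function.update Φ a (Function.update (Φ a) b ℓ)) i j').1 = p (s + 1))) ∨
      ∃ u : Fin n, v ∈ ((Finset.univ : Finset (Fin n)).filter fun v => ∃ p : ℕ → Fin n, p 0 = v ∧ p r = u ∧
        ∀ s, s < r → (p s = p (s + 1) ∨
          ∃ i : Fin m, ∃ j j' : Fin k, (Φ i j).1 = p s ∧ (Φ i j').1 = p (s + 1))) ∧
        ((∃ j : Fin k, (∃ (ll : ℕ) (xx : ℕ → Fin n), xx 0 = ((Φ a j).1) ∧ xx ll = u ∧ ∀ ss : ℕ, ss < ll →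
          (xx ss < xx (ss + 1) ∧ ∃ cc ∈ (Finset.univ : Finset (Fin m)), ∃ pp qq : Fin k,
            (Φ cc pp).1 = xx ss ∧ (Φ cc qq).1 = xx (ss + 1)))) ∨
          (∃ (ll : ℕ) (xx : ℕ → Fin n), xx 0 = ℓ.1 ∧ xx ll = u ∧ ∀ ss : ℕ, ss < ll →
          (xx ss < xx (ss + 1) ∧ ∃ cc ∈ (Finset.univ : Finset (Fin m)), ∃ pp qq : Fin k,
            (Φ cc pp).1 = xx ss ∧ (Φ cc qq).1 = xx (ss + 1)))) := by
  set Φ' := Function.update Φ a (Function.update (Φ a) b ℓ) with hΦ'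
  by_contra hnot
  rw [not_or, not_or] at hnot
  obtain ⟨h1, h2, h3⟩ := hnot
  apply hv
  apply hpost Φ Φ' v
  · intro i hi
    by_cases hia : i = a
    · exfalso
      subst hia
      rcases hi with ⟨j, pw, hp0, hpr, hst⟩ | ⟨j, pw, hp0, hpr, hst⟩
      · exact h1 (Finset.mem_filter.2 ⟨Finset.mem_univ _, j, pw, hp0, hpr, hst⟩)
      · exact h2 (Finset.mem_filter.2 ⟨Finset.mem_univ _, j, pw, hp0, hpr, hst⟩)
    · rw [hΦ', Function.update_of_ne hia]
  · intro u hu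
    by_contra hne
    obtain ⟨pw, hp0, hpr, hst⟩ := hu
    exact h3 ⟨u, Finset.mem_filter.2 ⟨Finset.mem_univ _, pw, hp0, hpr, hst⟩,
      shwSeq_cone g₀ hseq Φ a b ℓ u hne⟩

/-- **Bounded differences.** `d_H(g Φ, g Φ[(a,b) ↦ ℓ]) ≤ #Sees_r(a; Φ) + #Sees_r(a; Φ') +
(kD + 1)^r · (∑_q T_{∖a}(Φ, (Φ a q).1) + T(Φ, ℓ.1))`. -/
theorem shwSeqP_hamming_le (r : ℕ) (g₀ g : (Fin m → Fin k → Fin n × Bool) → (Fin n → Bool)) (hseq : (∀ (Φ Φ' : (Fin m → Fin k → Fin n × Bool)) (v : Fin n),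
        (∀ i : Fin m, ((∃ j : Fin k, (Φ i j).1 = v) ∨ (∃ j : Fin k, (Φ' i j).1 = v)) → Φ i = Φ' i) →
        (∀ (i : Fin m) (j j' : Fin k), (Φ i j).1 = v → (Φ i j').1 < v →
          g₀ Φ (Φ i j').1 = g₀ Φ' (Φ i j').1) →
        g₀ Φ v = g₀ Φ' v))
    (hpost : (∀ (Φ Φ' : (Fin m → Fin k → Fin n × Bool)) (v : Fin n),
        (∀ i : Fin m, ((∃ j : Fin k, ∃ pw : ℕ → Fin n, pw 0 = v ∧ pw r = (Φ i j).1 ∧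
          (∀ s, s < r → (pw s = pw (s + 1) ∨
            ∃ i' : Fin m, ∃ j₁ j₂ : Fin k, (Φ i' j₁).1 = pw s ∧ (Φ i' j₂).1 = pw (s + 1)))) ∨
         (∃ j : Fin k, ∃ pw : ℕ → Fin n, pw 0 = v ∧ pw r = (Φ' i j).1 ∧
          (∀ s, s < r → (pw s = pw (s + 1) ∨
            ∃ i' : Fin m, ∃ j₁ j₂ : Fin k, (Φ' i' j₁).1 = pw s ∧ (Φ' i' j₂).1 = pw (s + 1))))) → Φ i = Φ' i) →
        (∀ u : Fin n, (∃ pw : ℕ → Fin n, pw 0 = v ∧ pw r = u ∧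
          (∀ s, s < r → (pw s = pw (s + 1) ∨
            ∃ i' : Fin m, ∃ j₁ j₂ : Fin k, (Φ i' j₁).1 = pw s ∧ (Φ i' j₂).1 = pw (s + 1)))) → g₀ Φ u = g₀ Φ' u) →
        g Φ v = g Φ' v)) (Φ : (Fin m → Fin k → Fin n × Bool)) (a : Fin m) (b : Fin k) (ℓ : Fin n × Bool) :
    hammingDist (g Φ) (g (Function.update Φ a (Function.update (Φ a) b ℓ))) ≤
      (((Finset.univ : Finset (Fin n)).filter fun v => ∃ j : Fin k, ∃ p : ℕ → Fin n, p 0 = v ∧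
        p r = (Φ a j).1 ∧ ∀ s, s < r → (p s = p (s + 1) ∨
          ∃ i : Fin m, ∃ j j' : Fin k, (Φ i j).1 = p s ∧ (Φ i j').1 = p (s + 1)))).card +
      (((Finset.univ : Finset (Fin n)).filter fun v => ∃ j : Fin k, ∃ p : ℕ → Fin n, p 0 = v ∧
        p r = ((Function.update Φ a (Function.update (Φ a) b ℓ)) a j).1 ∧ ∀ s, s < r → (p s = p (s + 1) ∨
          ∃ i : Fin m, ∃ j j' : Fin k, ((Function.update Φ a (Function.update (Φ a) b ℓ)) i j).1 = p s ∧ ((Function.update Φ a (Function.update (Φ a) b ℓ)) i j').1 = p (s + 1)))).card +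
      (k * ((Finset.univ : Finset (Fin n)).sup fun v =>
          ((Finset.univ : Finset (Fin m)).filter fun i => ∃ j, (Φ i j).1 = v).card) + 1) ^ r *
        (∑ q : Fin k, ((Finset.univ : Finset (Fin n)).filter fun ww => (∃ (ll : ℕ) (xx : ℕ → Fin n), xx 0 = ((Φ a q).1) ∧ xx ll = ww ∧ ∀ ss : ℕ, ss < ll →
          (xx ss < xx (ss + 1) ∧ ∃ cc ∈ ((Finset.univ : Finset (Fin m)).erase a), ∃ pp qq : Fin k,
            (Φ cc pp).1 = xx ss ∧ (Φ cc qq).1 = xx (ss + 1)))).card +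
          ((Finset.univ : Finset (Fin n)).filter fun ww => (∃ (ll : ℕ) (xx : ℕ → Fin n), xx 0 = ℓ.1 ∧ xx ll = ww ∧ ∀ ss : ℕ, ss < ll →
          (xx ss < xx (ss + 1) ∧ ∃ cc ∈ (Finset.univ : Finset (Fin m)), ∃ pp qq : Fin k,
            (Φ cc pp).1 = xx ss ∧ (Φ cc qq).1 = xx (ss + 1)))).card) := by
  set Φ' := Function.update Φ a (Function.update (Φ a) b ℓ) with hΦ'
  set S1 := ((Finset.univ : Finset (Fin n)).filter fun v => ∃ j : Fin k, ∃ p : ℕ → Fin n, p 0 = v ∧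
        p r = (Φ a j).1 ∧ ∀ s, s < r → (p s = p (s + 1) ∨
          ∃ i : Fin m, ∃ j j' : Fin k, (Φ i j).1 = p s ∧ (Φ i j').1 = p (s + 1))) with hS1
  set S2 := ((Finset.univ : Finset (Fin n)).filter fun v => ∃ j : Fin k, ∃ p : ℕ → Fin n, p 0 = v ∧
        p r = (Φ' a j).1 ∧ ∀ s, s < r → (p s = p (s + 1) ∨
          ∃ i : Fin m, ∃ j j' : Fin k, (Φ' i j).1 = p s ∧ (Φ' i j').1 = p (s + 1))) with hS2
  set Ra : Fin k → Finset (Fin n) := fun q => (Finset.univ : Finset (Fin n)).filter fun ww =>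
      (∃ (ll : ℕ) (xx : ℕ → Fin n), xx 0 = ((Φ a q).1) ∧ xx ll = ww ∧ ∀ ss : ℕ, ss < ll →
          (xx ss < xx (ss + 1) ∧ ∃ cc ∈ ((Finset.univ : Finset (Fin m)).erase a), ∃ pp qq : Fin k,
            (Φ cc pp).1 = xx ss ∧ (Φ cc qq).1 = xx (ss + 1))) with hRa
  set Rl : Finset (Fin n) := (Finset.univ : Finset (Fin n)).filter fun ww =>
      (∃ (ll : ℕ) (xx : ℕ → Fin n), xx 0 = ℓ.1 ∧ xx ll = ww ∧ ∀ ss : ℕ, ss < ll →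
          (xx ss < xx (ss + 1) ∧ ∃ cc ∈ (Finset.univ : Finset (Fin m)), ∃ pp qq : Fin k,
            (Φ cc pp).1 = xx ss ∧ (Φ cc qq).1 = xx (ss + 1))) with hRl
  set Rall : Finset (Fin n) := (Finset.univ : Finset (Fin k)).biUnion Ra ∪ Rl with hRall
  set Bl : Fin n → Finset (Fin n) := fun u => ((Finset.univ : Finset (Fin n)).filter fun v => ∃ p : ℕ → Fin n, p 0 = v ∧ p r = u ∧
        ∀ s, s < r → (p s = p (s + 1) ∨
          ∃ i : Fin m, ∃ j j' : Fin k, (Φ i j).1 = p s ∧ (Φ i j').1 = p (s + 1))) with hBl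
  -- the difference set
  have hsub : ((Finset.univ : Finset (Fin n)).filter fun v => g Φ v ≠ g Φ' v) ⊆
      S1 ∪ S2 ∪ Rall.biUnion Bl := by
    intro v hv
    rw [Finset.mem_filter] at hv
    rcases shwSeqP_cone r g₀ g hseq hpost Φ a b ℓ v hv.2 with h | h | ⟨u, hvu, hu⟩
    · exact Finset.mem_union_left _ (Finset.mem_union_left _ h)
    · exact Finset.mem_union_left _ (Finset.mem_union_right _ h)
    · refine Finset.mem_union_right _ (Finset.mem_biUnion.2 ⟨u, ?_, hvu⟩)
      rcases hu with ⟨j, hj⟩ | hℓ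
      · obtain ⟨q, hq⟩ := shwSeq_cone_root Φ a j u hj
        exact Finset.mem_union_left _ (Finset.mem_biUnion.2 ⟨q, Finset.mem_univ _,
          Finset.mem_filter.2 ⟨Finset.mem_univ _, hq⟩⟩)
      · exact Finset.mem_union_right _ (Finset.mem_filter.2 ⟨Finset.mem_univ _, hℓ⟩)
  -- light cones
  have hball : ∀ u : Fin n, (Bl u).card ≤ (k * ((Finset.univ : Finset (Fin n)).sup fun v =>
          ((Finset.univ : Finset (Fin m)).filter fun i => ∃ j, (Φ i j).1 = v).card) + 1) ^ r := fun u =>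
    shwRad_card_ball_le Φ u r
  have hRall : Rall.card ≤ ∑ q : Fin k, (Ra q).card + Rl.card :=
    (Finset.card_union_le _ _).trans (Nat.add_le_add_right Finset.card_biUnion_le _)
  calc hammingDist (g Φ) (g Φ')
      = ((Finset.univ : Finset (Fin n)).filter fun v => g Φ v ≠ g Φ' v).card := rfl
    _ ≤ (S1 ∪ S2 ∪ Rall.biUnion Bl).card := Finset.card_le_card hsub
    _ ≤ (S1 ∪ S2).card + (Rall.biUnion Bl).card := Finset.card_union_le _ _
    _ ≤ S1.card + S2.card + ∑ u ∈ Rall, (Bl u).card :=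
        Nat.add_le_add (Finset.card_union_le _ _) Finset.card_biUnion_le
    _ ≤ S1.card + S2.card + ∑ _u ∈ Rall, (k * ((Finset.univ : Finset (Fin n)).sup fun v =>
          ((Finset.univ : Finset (Fin m)).filter fun i => ∃ j, (Φ i j).1 = v).card) + 1) ^ r :=
        Nat.add_le_add_left (Finset.sum_le_sum fun u _ => hball u) _
    _ = S1.card + S2.card + (k * ((Finset.univ : Finset (Fin n)).sup fun v =>
          ((Finset.univ : Finset (Fin m)).filter fun i => ∃ j, (Φ i j).1 = v).card) + 1) ^ r * Rall.card := by
        rw [Finset.sum_const, smul_eq_mul, mul_comm]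
    _ ≤ S1.card + S2.card + (k * ((Finset.univ : Finset (Fin n)).sup fun v =>
          ((Finset.univ : Finset (Fin m)).filter fun i => ∃ j, (Φ i j).1 = v).card) + 1) ^ r * (∑ q : Fin k, (Ra q).card + Rl.card) :=
        Nat.add_le_add_left (Nat.mul_le_mul_left _ hRall) _

/-- **Squared bounded differences at an instance of maximum clause-degree `≤ L`.**
`d_H² ≤ 8k²(kL+k+1)^{2r} + 2(k+1)(kL+k+1)^{2r}(∑_q T_{∖a,q}² + T_ℓ²)`. -/
theorem shwSeqP_hamming_sq_le (r : ℕ) (g₀ g : (Fin m → Fin k → Fin n × Bool) → (Fin n → Bool)) (hseq : (∀ (Φ Φ' : (Fin m → Fin k → Fin n × Bool)) (v : Fin n),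
        (∀ i : Fin m, ((∃ j : Fin k, (Φ i j).1 = v) ∨ (∃ j : Fin k, (Φ' i j).1 = v)) → Φ i = Φ' i) →
        (∀ (i : Fin m) (j j' : Fin k), (Φ i j).1 = v → (Φ i j').1 < v →
          g₀ Φ (Φ i j').1 = g₀ Φ' (Φ i j').1) →
        g₀ Φ v = g₀ Φ' v))
    (hpost : (∀ (Φ Φ' : (Fin m → Fin k → Fin n × Bool)) (v : Fin n),
        (∀ i : Fin m, ((∃ j : Fin k, ∃ pw : ℕ → Fin n, pw 0 = v ∧ pw r = (Φ i j).1 ∧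
          (∀ s, s < r → (pw s = pw (s + 1) ∨
            ∃ i' : Fin m, ∃ j₁ j₂ : Fin k, (Φ i' j₁).1 = pw s ∧ (Φ i' j₂).1 = pw (s + 1)))) ∨
         (∃ j : Fin k, ∃ pw : ℕ → Fin n, pw 0 = v ∧ pw r = (Φ' i j).1 ∧
          (∀ s, s < r → (pw s = pw (s + 1) ∨
            ∃ i' : Fin m, ∃ j₁ j₂ : Fin k, (Φ' i' j₁).1 = pw s ∧ (Φ' i' j₂).1 = pw (s + 1))))) → Φ i = Φ' i) →
        (∀ u : Fin n, (∃ pw : ℕ → Fin n, pw 0 = v ∧ pw r = u ∧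
          (∀ s, s < r → (pw s = pw (s + 1) ∨
            ∃ i' : Fin m, ∃ j₁ j₂ : Fin k, (Φ i' j₁).1 = pw s ∧ (Φ i' j₂).1 = pw (s + 1)))) → g₀ Φ u = g₀ Φ' u) →
        g Φ v = g Φ' v)) (Φ : (Fin m → Fin k → Fin n × Bool)) (L : ℝ) (hL : ((((Finset.univ : Finset (Fin n)).sup fun v =>
          ((Finset.univ : Finset (Fin m)).filter fun i => ∃ j, (Φ i j).1 = v).card) : ℕ) : ℝ) ≤ L)
    (a : Fin m) (b : Fin k) (ℓ : Fin n × Bool) :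
    ((hammingDist (g Φ) (g (Function.update Φ a (Function.update (Φ a) b ℓ))) : ℕ) : ℝ) ^ 2 ≤
      8 * (k : ℝ) ^ 2 * ((k : ℝ) * L + k + 1) ^ (2 * r) +
      2 * ((k : ℝ) + 1) * ((k : ℝ) * L + k + 1) ^ (2 * r) * (∑ q : Fin k,
        ((((Finset.univ : Finset (Fin n)).filter fun ww => (∃ (ll : ℕ) (xx : ℕ → Fin n), xx 0 = ((Φ a q).1) ∧ xx ll = ww ∧ ∀ ss : ℕ, ss < ll →
          (xx ss < xx (ss + 1) ∧ ∃ cc ∈ ((Finset.univ : Finset (Fin m)).erase a), ∃ pp qq : Fin k,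
            (Φ cc pp).1 = xx ss ∧ (Φ cc qq).1 = xx (ss + 1)))).card : ℕ) : ℝ) ^ 2 +
        ((((Finset.univ : Finset (Fin n)).filter fun ww => (∃ (ll : ℕ) (xx : ℕ → Fin n), xx 0 = ℓ.1 ∧ xx ll = ww ∧ ∀ ss : ℕ, ss < ll →
          (xx ss < xx (ss + 1) ∧ ∃ cc ∈ (Finset.univ : Finset (Fin m)), ∃ pp qq : Fin k,
            (Φ cc pp).1 = xx ss ∧ (Φ cc qq).1 = xx (ss + 1)))).card : ℕ) : ℝ) ^ 2) := by
  set Φ' := Function.update Φ a (Function.update (Φ a) b ℓ) with hΦ'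
  have h := shwSeqP_hamming_le r g₀ g hseq hpost Φ a b ℓ
  have hs1 := shwRad_card_sees_le Φ a r
  have hs2 := shwRad_card_sees_le Φ' a r
  have hDD : ((Finset.univ : Finset (Fin n)).sup fun v =>
          ((Finset.univ : Finset (Fin m)).filter fun i => ∃ j, (Φ' i j).1 = v).card) ≤ ((Finset.univ : Finset (Fin n)).sup fun v =>
          ((Finset.univ : Finset (Fin m)).filter fun i => ∃ j, (Φ i j).1 = v).card) + 1 := by
    rw [hΦ']; exact sissT_maxdeg_update_le Φ a (Function.update (Φ a) b ℓ)
  set D : ℕ := ((Finset.univ : Finset (Fin n)).sup fun v =>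
          ((Finset.univ : Finset (Fin m)).filter fun i => ∃ j, (Φ i j).1 = v).card) with hD
  set D' : ℕ := ((Finset.univ : Finset (Fin n)).sup fun v =>
          ((Finset.univ : Finset (Fin m)).filter fun i => ∃ j, (Φ' i j).1 = v).card) with hD'
  set X : ℕ := ∑ q : Fin k, ((Finset.univ : Finset (Fin n)).filter fun ww => (∃ (ll : ℕ) (xx : ℕ → Fin n), xx 0 = ((Φ a q).1) ∧ xx ll = ww ∧ ∀ ss : ℕ, ss < ll →
          (xx ss < xx (ss + 1) ∧ ∃ cc ∈ ((Finset.univ : Finset (Fin m)).erase a), ∃ pp qq : Fin k,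
            (Φ cc pp).1 = xx ss ∧ (Φ cc qq).1 = xx (ss + 1)))).card +
      ((Finset.univ : Finset (Fin n)).filter fun ww => (∃ (ll : ℕ) (xx : ℕ → Fin n), xx 0 = ℓ.1 ∧ xx ll = ww ∧ ∀ ss : ℕ, ss < ll →
          (xx ss < xx (ss + 1) ∧ ∃ cc ∈ (Finset.univ : Finset (Fin m)), ∃ pp qq : Fin k,
            (Φ cc pp).1 = xx ss ∧ (Φ cc qq).1 = xx (ss + 1)))).card with hX
  -- in `ℕ`: `d ≤ k(kD+1)^r + k(k(D+1)+1)^r + (kD+1)^r X`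
  have hnat : hammingDist (g Φ) (g Φ') ≤
      k * (k * D + 1) ^ r + k * (k * (D + 1) + 1) ^ r + (k * D + 1) ^ r * X := by
    refine h.trans ?_
    refine Nat.add_le_add (Nat.add_le_add hs1 (hs2.trans ?_)) le_rfl
    have hb : k * D' + 1 ≤ k * (D + 1) + 1 := by
      have := Nat.mul_le_mul_left k hDD; omega
    exact Nat.mul_le_mul_left k (Nat.pow_le_pow_left hb r)
  -- cast and relax to the common base `P = kL + k + 1`
  have hk0 : (0 : ℝ) ≤ k := Nat.cast_nonneg _
  have hD0 : (0 : ℝ) ≤ D := Nat.cast_nonneg _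
  have hDL : (D : ℝ) ≤ L := by rw [hD]; exact hL
  have hL0 : 0 ≤ L := hD0.trans hDL
  set P : ℝ := (k : ℝ) * L + k + 1 with hP
  have hP0 : 0 ≤ P := by rw [hP]; positivity
  have hb1 : ((k : ℝ) * D + 1) ^ r ≤ P ^ r :=
    pow_le_pow_left₀ (by positivity) (by rw [hP]; nlinarith) r
  have hb2 : ((k : ℝ) * (D + 1) + 1) ^ r ≤ P ^ r :=
    pow_le_pow_left₀ (by positivity) (by rw [hP]; nlinarith) r
  have hX0 : (0 : ℝ) ≤ (X : ℝ) := Nat.cast_nonneg _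
  have hR : ((hammingDist (g Φ) (g Φ') : ℕ) : ℝ) ≤ 2 * k * P ^ r + P ^ r * X := by
    have h1 : ((hammingDist (g Φ) (g Φ') : ℕ) : ℝ) ≤
        ((k * (k * D + 1) ^ r + k * (k * (D + 1) + 1) ^ r + (k * D + 1) ^ r * X : ℕ) : ℝ) := by
      exact_mod_cast hnat
    push_cast at h1
    nlinarith [mul_le_mul_of_nonneg_left hb1 hk0, mul_le_mul_of_nonneg_left hb2 hk0,
      mul_le_mul_of_nonneg_right hb1 hX0]
  -- square: `(2kP^r + P^r X)² ≤ 2(2kP^r)² + 2 P^{2r} X²`, and `X² ≤ (k+1)(Σ T² )`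
  have hXsq : ((X : ℕ) : ℝ) ^ 2 ≤ ((k : ℝ) + 1) * (∑ q : Fin k,
        ((((Finset.univ : Finset (Fin n)).filter fun ww => (∃ (ll : ℕ) (xx : ℕ → Fin n), xx 0 = ((Φ a q).1) ∧ xx ll = ww ∧ ∀ ss : ℕ, ss < ll →
          (xx ss < xx (ss + 1) ∧ ∃ cc ∈ ((Finset.univ : Finset (Fin m)).erase a), ∃ pp qq : Fin k,
            (Φ cc pp).1 = xx ss ∧ (Φ cc qq).1 = xx (ss + 1)))).card : ℕ) : ℝ) ^ 2 +
        ((((Finset.univ : Finset (Fin n)).filter fun ww => (∃ (ll : ℕ) (xx : ℕ → Fin n), xx 0 = ℓ.1 ∧ xx ll = ww ∧ ∀ ss : ℕ, ss < ll →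
          (xx ss < xx (ss + 1) ∧ ∃ cc ∈ (Finset.univ : Finset (Fin m)), ∃ pp qq : Fin k,
            (Φ cc pp).1 = xx ss ∧ (Φ cc qq).1 = xx (ss + 1)))).card : ℕ) : ℝ) ^ 2) := by
    -- Cauchy–Schwarz over `Option (Fin k)`
    set x : Option (Fin k) → ℝ := fun o => Option.elim o
        ((((Finset.univ : Finset (Fin n)).filter fun ww => (∃ (ll : ℕ) (xx : ℕ → Fin n), xx 0 = ℓ.1 ∧ xx ll = ww ∧ ∀ ss : ℕ, ss < ll →
          (xx ss < xx (ss + 1) ∧ ∃ cc ∈ (Finset.univ : Finset (Fin m)), ∃ pp qq : Fin k,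
            (Φ cc pp).1 = xx ss ∧ (Φ cc qq).1 = xx (ss + 1)))).card : ℕ) : ℝ)
        (fun q => ((((Finset.univ : Finset (Fin n)).filter fun ww => (∃ (ll : ℕ) (xx : ℕ → Fin n), xx 0 = ((Φ a q).1) ∧ xx ll = ww ∧ ∀ ss : ℕ, ss < ll →
          (xx ss < xx (ss + 1) ∧ ∃ cc ∈ ((Finset.univ : Finset (Fin m)).erase a), ∃ pp qq : Fin k,
            (Φ cc pp).1 = xx ss ∧ (Φ cc qq).1 = xx (ss + 1)))).card : ℕ) : ℝ)) with hx
    have hsumx : ∑ o : Option (Fin k), x o = ((X : ℕ) : ℝ) := by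
      rw [Fintype.sum_option, hX]; push_cast; simp only [hx, Option.elim]; ring
    have hsumx2 : ∑ o : Option (Fin k), x o ^ 2 =
        ((((Finset.univ : Finset (Fin n)).filter fun ww => (∃ (ll : ℕ) (xx : ℕ → Fin n), xx 0 = ℓ.1 ∧ xx ll = ww ∧ ∀ ss : ℕ, ss < ll →
          (xx ss < xx (ss + 1) ∧ ∃ cc ∈ (Finset.univ : Finset (Fin m)), ∃ pp qq : Fin k,
            (Φ cc pp).1 = xx ss ∧ (Φ cc qq).1 = xx (ss + 1)))).card : ℕ) : ℝ) ^ 2 + ∑ q : Fin k,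
        ((((Finset.univ : Finset (Fin n)).filter fun ww => (∃ (ll : ℕ) (xx : ℕ → Fin n), xx 0 = ((Φ a q).1) ∧ xx ll = ww ∧ ∀ ss : ℕ, ss < ll →
          (xx ss < xx (ss + 1) ∧ ∃ cc ∈ ((Finset.univ : Finset (Fin m)).erase a), ∃ pp qq : Fin k,
            (Φ cc pp).1 = xx ss ∧ (Φ cc qq).1 = xx (ss + 1)))).card : ℕ) : ℝ) ^ 2 := by
      rw [Fintype.sum_option]; rfl
    have hcs : (∑ o : Option (Fin k), x o) ^ 2 ≤
        (Finset.univ : Finset (Option (Fin k))).card * ∑ o : Option (Fin k), x o ^ 2 :=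
      sq_sum_le_card_mul_sum_sq
    rw [Finset.card_univ, Fintype.card_option, Fintype.card_fin, hsumx, hsumx2] at hcs
    push_cast at hcs
    linarith [hcs]
  have h0 : (0 : ℝ) ≤ ((hammingDist (g Φ) (g Φ') : ℕ) : ℝ) := Nat.cast_nonneg _
  have hPr0 : 0 ≤ P ^ r := pow_nonneg hP0 r
  have hP2r : (P ^ r) ^ 2 = P ^ (2 * r) := by rw [← pow_mul, mul_comm]
  calc ((hammingDist (g Φ) (g Φ') : ℕ) : ℝ) ^ 2
      ≤ (2 * k * P ^ r + P ^ r * X) ^ 2 := pow_le_pow_left₀ h0 hR 2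
    _ ≤ 2 * (2 * k * P ^ r) ^ 2 + 2 * (P ^ r * X) ^ 2 := by nlinarith [sq_nonneg (2 * k * P ^ r - P ^ r * X)]
    _ = 8 * (k : ℝ) ^ 2 * P ^ (2 * r) + 2 * P ^ (2 * r) * ((X : ℕ) : ℝ) ^ 2 := by rw [← hP2r]; ring
    _ ≤ 8 * (k : ℝ) ^ 2 * P ^ (2 * r) + 2 * P ^ (2 * r) * (((k : ℝ) + 1) * (∑ q : Fin k,
        ((((Finset.univ : Finset (Fin n)).filter fun ww => (∃ (ll : ℕ) (xx : ℕ → Fin n), xx 0 = ((Φ a q).1) ∧ xx ll = ww ∧ ∀ ss : ℕ, ss < ll →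
          (xx ss < xx (ss + 1) ∧ ∃ cc ∈ ((Finset.univ : Finset (Fin m)).erase a), ∃ pp qq : Fin k,
            (Φ cc pp).1 = xx ss ∧ (Φ cc qq).1 = xx (ss + 1)))).card : ℕ) : ℝ) ^ 2 +
        ((((Finset.univ : Finset (Fin n)).filter fun ww => (∃ (ll : ℕ) (xx : ℕ → Fin n), xx 0 = ℓ.1 ∧ xx ll = ww ∧ ∀ ss : ℕ, ss < ll →
          (xx ss < xx (ss + 1) ∧ ∃ cc ∈ (Finset.univ : Finset (Fin m)), ∃ pp qq : Fin k,
            (Φ cc pp).1 = xx ss ∧ (Φ cc qq).1 = xx (ss + 1)))).card : ℕ) : ℝ) ^ 2)) := by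
        have : 0 ≤ 2 * P ^ (2 * r) := by positivity
        nlinarith [mul_le_mul_of_nonneg_left hXsq this]
    _ = _ := by ring

end SeqPost

end Summit.PneNP.PneNP.Theorems
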